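import Summits.Langlands.Langlands.Theses.SkinnerWilesDefectOne
import Summits.Langlands.Langlands.Theorems.ProModularOrdinaryClassical.Negative.LoadBearing
import Summits.Langlands.Langlands.Theorems.SkinnerWilesDefectOneProModularOrdinaryClassicalCentralDiamondWeight
import Summits.Langlands.Langlands.Theorems.SkinnerWilesDefectOneProModularOrdinaryClassicalSatakeDictionary
import Summits.Langlands.Langlands.Theorems.SkinnerWilesDefectOneProModularOrdinaryClassicalDominantGlue
import Summits.Langlands.Langlands.Theorems.SkinnerWilesDefectOneProModularOrdinaryClassicalDominantPointsClassical
import Summits.Langlands.Langlands.Theorems.SkinnerWilesDefectOneProModularOrdinaryClassicalSlopeZeroFactorisation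
import Summits.Langlands.Langlands.Theorems.SkinnerWilesDefectOneProModularOrdinaryClassicalOrdinaryExit
import Summits.Langlands.Langlands.Theorems.SkinnerWilesDefectOneProModularOrdinaryClassicalOfBianchiFinitenessHidaFinite
import Summits.Langlands.Langlands.Theorems.SkinnerWilesDefectOneProModularOrdinaryClassicalGivenBianchiFiniteness
import Literature.NumberTheory.Automorphic.ArithmeticQuotientCohomologyFinite
import Literature.NumberTheory.Automorphic.OrdinaryCompletedCohomologyGL
import Literature.NumberTheory.Automorphic.BianchiOrdinaryClassicality
import Summits.Langlands.Langlands.Theorems.SkinnerWilesDefectOneProModularOrdinaryClassicalCmInducedCuspidal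
import Summits.Langlands.Langlands.Theorems.SkinnerWilesDefectOneProModularOrdinaryClassicalCmSatakeFrobGlue
import Literature.NumberTheory.Automorphic.AutomorphicInductionCuspidal
import Literature.NumberTheory.Automorphic.HenniartAutomorphicInduction
import Literature.NumberTheory.GaloisRepresentations.HeckeCharacter

/-!
# Line `top-degree-exact-control` for the crux `SkinnerWilesDefectOne.ProModularOrdinaryClassical`
(stmt-Langlands-12921, THE EXIT) — LEAD'S SKELETON, rev 10 (prover-line-stmt-Langlands-12921-c6-0, 2026-08-16T17:15Z: rev 9
RE-REGISTERED VERBATIM by the continuation lead c6 (seventh lead seat) — same four stubs, same composition; see "Rev 10" below;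
rev 9 = lead c4's verbatim re-registration of lead c3's rev 8, also re-registered unchanged by lead c5 at 16:56Z; rev 8 =
lead c2's rev 6b with the route-choice planner's Borel–Serre rewiring applied (rev 7) and fact (C) of fact-stub 1d discharged
(rev 8) — see "Rev 7" / "Rev 8" below; continuation of rev 6b by
prover-line-stmt-Langlands-12921-c2-0, rev 5 by prover-line-stmt-Langlands-12921-c1-0 and rev 3c by
prover-line-stmt-Langlands-12921-0; planner's `Lines/top-degree-exact-control.lean`, card `Lines/top-degree-exact-control.md`,
idea `Ideas/top-degree-exact-control.md`, triage `TRIAGE-r1-{1,2,3}.md`).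

**Rev 10 (lead c6, this seat).** No stub changes and no movable stub: at 2026-08-16T17:12Z none of the five printed facts
(`automorphicInduction_cyclic_cuspidal`, `Henniart2012_infinityType_of_automorphicInduction`, `hidaControl_dominantOrdinaryPoint`,
`bianchi_interiorEigenclass_isCuspidal`, `bianchi_boundaryEigensystem_isReducible`) nor crux #7 `BianchiCongruenceCohomologyFinite`
has a `_holds` theorem, none is fact-claimed (their leaf reductions run in > 40 Literature files of literature seats), the route file is
at rev 22 (no `@[conjecture]` bridge for the open core; engine stmt-Langlands-12919 not retyped), `Disproof.lean` is gen 3 cycle 3 of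
05:33Z.  The open core `stub_ordinaryFactorisationIwahoriNonCM` is handed back a fourth time (PROMOTE-c6.md).

**Rev 9 (lead c4).** No stub changes: the four registered stubs of rev 8 are re-registered under this seat
(`stub_ordinaryFactorisationIwahoriNonCM` = the OPEN CORE, held by the lead; `stub_facts_automorphicInductionAB`,
`stub_fact_bianchiCongruenceFinite` = route crux #7 by name, `stub_facts_bianchiClassicality` = literature debt, each
blocked on EXISTING named facts / the item stmt-Langlands-15362, all in other seats' queues — none of the five printed facts has
a `_holds` theorem yet, 2026-08-16T16:40Z).  The composition is unchanged and still concludes the crux BY NAME.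

**Rev 7 (lead c3).** The XL-apex fact-stub 3a `stub_fact_borelSerreCongruence` (ALL `n`, ALL number fields:
`Literature.NumberTheory.Automorphic.BorelSerre1973_finite_groupCohomology_congruenceSubgroup`) is REPLACED by the one-line
crux-stub `stub_fact_bianchiCongruenceFinite : BianchiCongruenceCohomologyFinite` — the route's own crux #7
(stmt-Langlands-15362, route rev 21: Borel–Serre finiteness for congruence subgroups of `GL₂` over IMAGINARY QUADRATIC fields,
finite coefficients, exactly the instance this line consumes), discharged BY NAME the day `BianchiCongruenceCohomologyFinite_holds`
is appended to the route file; stub 3 `stub_hidaCohomology_finite` is restated at imaginary quadratic `F` (the only fields at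
which the composition applies it) and PROVED from the crux-stub by the landed rewiring certificate
`BianchiFiniteness.hidaCohomology_finite_of_bianchi` (`Theorems/SkinnerWilesDefectOneProModularOrdinaryClassicalOfBianchiFinitenessHidaFinite.lean`:
in-tree Shapiro over the finitely many components); `ordinaryFactorisationDominant_of_stubs` passes `hF hdeg` to it.  Every
other stub is byte-identical to rev 6b.  (Planner evidence `line-rev7.lean` / `RCHOICE-borelserre.md`, 2026-08-16T15:31Z.)

**Rev 8 (lead c3).** Fact-stub 1d loses its third conjunct (C) "infinity types exist for every `GL_n` datum" (Clozel 1990 §3.3):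
the landed stub 1b used it only at `n = 2`, a THEOREM of the tree (`RegularTwistCM.exists_hasInfinityType_gl_two`), and the glue-item
seat (stmt-Langlands-15365) landed `GivenBianchiFiniteness.cmInducedCuspidal_of_two_facts` (p112953) = stub 1b modulo (A), (B) only;
the composition's CM branch now calls it.  Registered fact-stub renamed `stub_facts_automorphicInductionAB : (A) ∧ (B)`; the crux's
literature debt is down to FIVE printed facts + crux #7 + the open core.

**Idea.** A characteristic-0 point `x` of Hida's ORDINARY big Hecke algebra `𝕋^{S,ord}(𝒰)`
(`OrdinaryHeckeAlgebraGLn 𝒰`, constructed in the tree) whose diamond character is the DOMINANT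
arithmetic character of parallel weight `k ≥ 2` is classical, with NO torsion-freeness input
(Khare–Thorne's perfect `Λ`-complex of the Bianchi Hida tower is exact in the top degree; Nakayama at the
characteristic-0 prime `𝔭_x ⊇ P_k`; Franke/Harder).  What separates this from the crux is (OF)
Galois-ordinary ⇒ Hecke-ordinary, the TRANSFER slot = the crux's open core, shared with every line.

**State at rev 6 (this seat's reshape of the CM regime).** LANDED and imported, unchanged from rev 5:
`stub_centralDiamondWeight` (p85822), `stub_satakeDictionary` (p86662), `stub_dominantOfCentralAndSlotZero` (p89308),
`stub_dominantPointsClassical` (p89646, modulo the three printed Bianchi facts), `stub_slopeZeroFactorisation` (p98105,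
Khare–Thorne Lemma 2.10), the composed exit `classical_of_ordinaryPoint` (p96987) and the finiteness reduction
`TameLevel.hidaCohomology_finite_of_borelSerre` (p98716).  Rev 5 isolated the quadratically INDUCED regime in lineage 1's
`stub_cruxOfQuadraticallyInduced` (trace-induced `ρ` ⇒ classical), whose proof needs a Galois-side local analysis at `p`
followed by Serre's "locally algebraic ⇒ algebraic Hecke character" in a Galois-inertia form the tree cannot bridge to its
(proved, idelic) `exists_heckeCharacter_of_isLocAlgAt` (no pinned local reciprocity above `p`).  Rev 6 moves the cut of the
case split to the AUTOMORPHIC seam, where everything is printed or provable: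

* case (CM): through the crux's own `ι`, `ρ` has almost everywhere the Frobenius polynomials
  `∏_{w ∣ v} (X^{f(w|v)} − ι⁻¹(θ(ϖ_w))⁻¹)` induced from an ALGEBRAIC Hecke character `θ` of a quadratic extension `K/F`
  that is regular (`θ(ϖ_{w'}) ≠ θ(ϖ_w)` for infinitely many pairs `w, w'` over one place of `F`) ⇒
  `stub_cmInducedCuspidal` (cuspidal automorphic induction of `θ`, Arthur–Clozel Thm. 6.2/Lemma 6.4 at `n = 1`, through the
  tree's `exists_cuspidal_of_isGalois_prime_of_frequently_ne`; L-algebraicity from Henniart's archimedean components and the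
  integral infinity type of `θ`) and `stub_cmSatakeFrobGlue` (polynomial algebra: induced Satake polynomial ⇒
  `SatakeFrobCompatibleAt`); the printed inputs ride in the fact-stub `stub_facts_automorphicInductionAB` (rev 8: (A) ∧ (B); (C) discharged at rank 2);
* case (non-CM): `stub_ordinaryFactorisationIwahoriNonCM` = OF_Iw of rev 4 with the extra hypothesis ¬(CM) — a statement
  implied by c1's registered `stub_ordinaryFactorisationIwahori` (rev 4) and implying its `…Primitive` (rev 5) given the
  paper fact that an induced `ρ` ordinary of parallel weight `k ≥ 2` at every `v ∣ p` is CM-algebraic; the OPEN CORE,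
  unchanged in nature.

Open `sorry`s at rev 7: the open core `stub_ordinaryFactorisationIwahoriNonCM` + the crux-stub
`stub_fact_bianchiCongruenceFinite` (route crux #7) + two literature-debt fact-stubs (`stub_facts_automorphicInductionAB`,
`stub_facts_bianchiClassicality`) — BOTH CM stubs LANDED (p105721 `stub_cmInducedCuspidal`, p106683 `stub_cmSatakeFrobGlue`)
and are imported.
Composition: `[CM] cmInducedCuspidal → cmSatakeFrobGlue → crux`; `[non-CM] OF_Iw-nonCM → SZF (+finiteness) →
[central weight, glue] → dominant points classical (+3 facts) → Satake dictionary → crux`, pure logic (§3).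

**Disproof used** (`Cruxes/ProModularOrdinaryClassical/Disproof.lean`, cdisprove gen 3 cycle 3, re-read 2026-08-16T12:45Z):
no `¬`-theorem and no `_false_without_` theorem on the crux (§0 `crux_of_ordinaryFontaineMazur`: the crux is FM(B) in its
sector + `hpm`; `hpm` is consumed in OF_Iw-nonCM only); §9 T2b (`stub_slotZeroDiamondWeight` dead as a ∀-points statement,
`Negative/SlotZeroWeight.lean`) stays absorbed in the ∃ of OF_Iw-nonCM; §1c `0 < m`, §1d `2 ≤ k`, §1e irreducibility are
hypotheses of OF_Iw-nonCM and of the landed stubs; §1a `hunr` is decoration (`hunr_redundant`); §10 3(a) (the `∀ ι` binder is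
not a loophole) is why the CM predicate may and must be stated through the crux's `ι`.  Negatives index: 1 unrelated entry.
-/

namespace Summit.Langlands.Langlands.Cruxes.ProModularOrdinaryClassical.TopDegreeExactControl

set_option linter.dupNamespace false
set_option linter.unusedVariables false

open Summit.Langlands.Langlands.Theses.SkinnerWilesDefectOne
open Summit.Langlands.Langlands.Theorems.ProModularOrdinaryClassical.Negative
open Literature.NumberTheory.Automorphic Literature.NumberTheory.GaloisRepresentations
open Literature.NumberTheory.Automorphic.BigHeckeGLn
open NumberField IsDedekindDomain Filter Polynomial
open scoped BigOperators Classical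

noncomputable section

/-! ## 1. The registered stubs (the ONLY `sorry`s of the file; each a closed, fully qualified one-line statement,
restated byte-for-byte by its Theorems-side proof). -/

/-- **Stub 1 — (OF_Iw, NON-CM ρ) ordinary factorisation, Iwahori slope-zero form (TRANSFER slot; the line's open core,
rev 6; held by the lead).** Rev 6 replaces rev 5's primitivity hypothesis (no quadratic `K/F` and `ψ` with `tr ρ = tr Ind ψ`)
by the weaker, automorphic-side exclusion ¬(CM): there are NO quadratic extension `K/F`, algebraic Hecke character `θ` of
`K`, regular above infinitely many places, such that `ρ` has through `ι` the `θ`-induced Frobenius polynomials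
`∏_{w ∣ v} (X^{f(w|v)} − ι⁻¹(θ(ϖ_w))⁻¹)` at almost all `v` (that regime is settled by `stub_cmInducedCuspidal` +
`stub_cmSatakeFrobGlue` without any (OF)).  Under the crux's hypotheses (irreducible, a.e. unramified, `p`-adically
automorphic of some tame level, ordinary of the parallel weight `k ≥ 2` with exponent `m > 0` at every `v ∣ p`), there are a
tame level `𝒰` MAXIMAL ABOVE `p` and a CONTINUOUS `ℚ̄_p`-point `y` of the big Hecke algebra of its Hida (Iwahori) tower
`𝕋^S(𝒰; p) = HidaHeckeAlgebraGLn 𝒰` such that: `ρ` is associated with `y` (`IsHidaAssociated`), `y` has SLOPE ZERO at every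
`v ∣ p` (`IsSlopeZeroAt`: `y(U_{v,1})^{m!} → 1`), and the slot-`0` diamond character `u ↦ ∏_{v∣p} y(⟨diag(û_v, 1)⟩_v)` has
finite order on the global units-above-`p` (the ORDERING bit: `y` is the dominant refinement — Disproof §9 T2b).
Mathematically: ordinary local–global compatibility for completed cohomology of `GL₂/F` in the Galois ⇒ Hecke direction
(known over `ℚ`: Emerton 2011; over `F` only Hecke ⇒ Galois: CaraianiNewton2023 Thm 4.2.15, AHTW2026).  OPEN in every residual
regime for `p`-adic (non-classical) points over an imaginary quadratic field as of 2026-08.  Implied by c1's registered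
`stub_ordinaryFactorisationIwahori` (rev 4, no exclusion); implies rev 5's `…Primitive` modulo the paper fact "induced +
ordinary of parallel weight ⇒ CM-algebraic".  This is where `hpm` is consumed (Disproof §0); uses `0 < m`, `2 ≤ k`,
irreducibility. Size XL (open).
[cite: Emerton2011LocalGlobal, Thm. 1.2.1] [cite: CaraianiNewton2023, Thm. 4.2.15] [cite: KhareThorne2017, §6.5, Conj. 6.18] -/
theorem stub_ordinaryFactorisationIwahoriNonCM : ∀ (F : Type) [Field F] [NumberField F], NumberField.IsTotallyComplex F → Module.finrank ℚ F = 2 → ∀ (p : ℕ) [Fact p.Prime], p ≠ 2 → ∀ (ι : PadicAlgCl p ≃+* ℂ) (ρ : Literature.NumberTheory.GaloisRepresentations.FramedGaloisRep F (PadicAlgCl p) 2) (k m : ℕ), ρ.toGaloisRep.IsIrreducible → (¬ ∃ (K : Type) (_ : Field K) (_ : NumberField K) (_ : Algebra F K) (_ : Module.finrank F K = 2) (θ : Literature.NumberTheory.GaloisRepresentations.HeckeCharacter K), θ.IsAlgebraic ∧ (∃ᶠ w : IsDedekindDomain.HeightOneSpectrum (NumberField.RingOfIntegers K) in Filter.cofinite,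 ∃ w' : IsDedekindDomain.HeightOneSpectrum (NumberField.RingOfIntegers K), w'.asIdeal.under (NumberField.RingOfIntegers F) = w.asIdeal.under (NumberField.RingOfIntegers F) ∧ θ.valueAtUniformizer w' ≠ θ.valueAtUniformizer w) ∧ ∀ᶠ v : IsDedekindDomain.HeightOneSpectrum (NumberField.RingOfIntegers F) in Filter.cofinite, ρ.IsUnramifiedAt v ∧ ρ.HasFrobCharpolyAt v (∏ᶠ w ∈ {w : IsDedekindDomain.HeightOneSpectrum (NumberField.RingOfIntegers K) | w.under (NumberField.RingOfIntegers F) = v}, (Polynomial.X ^ w.asIdeal.inertiaDeg (NumberField.RingOfIntegers F) - Polynomial.C (ι.symm (θ.valueAtUniformizer w)⁻¹)))) → (∀ᶠ v in Filter.cofinite, ρ.IsUnramifiedAt v) → (∃ 𝒰 : Literature.NumberTheory.Automorphic.BigHeckeGLn.TameLevel 2 F p, 𝒰.IsPadicallyAutomorphic ρ) → 2 ≤ k → 0 < m → (∀ v : IsDedekindDomain.HeightOneSpectrum (NumberField.RingOfIntegers F), (p : NumberField.RingOfIntegers F) ∈ v.asIdeal → ρ.IsOrdinaryOfWeightAt p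 v k m) → ∃ 𝒰 : Literature.NumberTheory.Automorphic.BigHeckeGLn.TameLevel 2 F p, 𝒰.IsMaximalAbove ∧ ∃ y : Literature.NumberTheory.Automorphic.HidaHeckeAlgebraGLn 𝒰 →+* PadicAlgCl p, Continuous y ∧ 𝒰.IsHidaAssociated y ρ ∧ (∀ v : IsDedekindDomain.HeightOneSpectrum (NumberField.RingOfIntegers F), (p : NumberField.RingOfIntegers F) ∈ v.asIdeal → 𝒰.IsSlopeZeroAt y v) ∧ ∃ N : ℕ, 0 < N ∧ ∀ (u : NumberField.RingOfIntegers F) (û : ∀ v : IsDedekindDomain.HeightOneSpectrum (NumberField.RingOfIntegers F), (p : NumberField.RingOfIntegers F) ∈ v.asIdeal → (v.adicCompletionIntegers F)ˣ), (∀ (v : IsDedekindDomain.HeightOneSpectrum (NumberField.RingOfIntegers F)) (hv : (p : NumberField.RingOfIntegers F) ∈ v.asIdeal), ((û v hv : v.adicCompletionIntegers F) : v.adicCompletion F) = algebraMap F (v.adicCompletion F) (u : F)) → (∏ᶠ v : {v : IsDedekindDomain.HeightOneSpectrum (NumberField.RingOfIntegers F) // (p : NumberField.RingOfIntegers F) ∈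 v.asIdeal}, y (𝒰.hidaDiamond v.2 (Pi.mulSingle (0 : Fin 2) (û v.1 v.2)))) ^ N = 1 := by
  sorry

/-! **Stub 2 — `stub_slopeZeroFactorisation`: LANDED (p98105), imported from
`Theorems/SkinnerWilesDefectOneProModularOrdinaryClassicalSlopeZeroFactorisation.lean` (same namespace, registered signature). -/

/-! **Stub 1b — `stub_cmInducedCuspidal`: LANDED (p105721, wave 1 of this seat), imported from
`Theorems/SkinnerWilesDefectOneProModularOrdinaryClassicalCmInducedCuspidal.lean` (same namespace, registered signature):
cuspidal automorphic induction of a regular algebraic Hecke character through a quadratic extension, L-algebraic, with the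
induced Satake polynomials, modulo three printed facts; rev 8 uses instead the landed `GivenBianchiFiniteness.cmInducedCuspidal_of_two_facts`
(p112953: the same with the third input, rank-`n` infinity types, discharged at `n = 2` by `RegularTwistCM.exists_hasInfinityType_gl_two`).

**Stub 1c — `stub_cmSatakeFrobGlue`: LANDED (p106683, wave 1 of this seat), imported from
`Theorems/SkinnerWilesDefectOneProModularOrdinaryClassicalCmSatakeFrobGlue.lean` (same namespace, registered signature):
induced Satake polynomial + induced arithmetic-Frobenius polynomial ⇒ `SatakeFrobCompatibleAt` a.e. (pure algebra). -/

/-- **Stub 1d (fact-stub, rev 8: TWO facts) — the PRINTED automorphic inputs of the CM regime, carried as ONE registered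
literature debt** (named facts, each a `def … : Prop` of the tree with its locator; discharge = `theorem …_holds`, after which
this bundle is re-registered smaller): (A) `automorphicInduction_cyclic_cuspidal` [cite: ArthurClozelAMS120, Ch. 3 Thm. 6.2
(proof, PDF p. 185) and Lemma 6.4]; (B) `Henniart2012_infinityType_of_automorphicInduction` [cite: Henniart2012, §1.10, Thm. 3 (i),
Thm. 4, Thm. 5 and Remarque §3.7].  Rev 8 DROPS rev 6's third conjunct (C) "`AutomorphicRepData.exists_hasInfinityType` for every
`GL_n` datum" [cite: Clozel1990, §3.3]: the landed stub 1b consumed it only at `n = 2`, where it is a THEOREM of the tree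
(`RegularTwistCM.exists_hasInfinityType_gl_two`), and the landed `GivenBianchiFiniteness.cmInducedCuspidal_of_two_facts` (p112953,
glue-item seat stmt-Langlands-15365) is stub 1b with (C) so discharged. -/
theorem stub_facts_automorphicInductionAB : Literature.NumberTheory.Automorphic.automorphicInduction_cyclic_cuspidal ∧ Literature.NumberTheory.Automorphic.Henniart2012_infinityType_of_automorphicInduction := by
  sorry

/-- **Stub 3a (crux-stub, rev 7) — Borel–Serre finiteness for congruence subgroups of `GL₂` over an IMAGINARY QUADRATIC
field with finite coefficients = the route's crux #7 `BianchiCongruenceCohomologyFinite`** (stmt-Langlands-15362, route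
rev 21): for `K` imaginary quadratic, `U ≤ GL₂(𝔸_K^∞)` compact open, `Γ_U = GL₂(K) ∩ U` and `A : Rep ℤ Γ_U` finite, every
`H^q(Γ_U, A)` is finite (Bianchi congruence subgroups are of type (WFL)).  Rev 7 replaces rev 5's all-`n`, all-fields
fact-stub `stub_fact_borelSerreCongruence` (judged XL-apex by the route-choice planner, 2026-08-16T15:31Z) by this one-line
reference to the crux, discharged BY NAME (`BianchiCongruenceCohomologyFinite_holds`) when that item closes.
[cite: BorelSerre1973, §11.1; Thm. 11.4.4] [cite: Serre1971CohomologieGroupesDiscrets, §2.4 Th. 4 (a); §1.8 Remarque]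
[cite: Brown1982CohomologyGroups, VIII (5.1); VIII.4 Exercise 1] -/
theorem stub_fact_bianchiCongruenceFinite : BianchiCongruenceCohomologyFinite := by
  sorry

/-- **Stub 3 (rev 7: at imaginary quadratic `F`) — the cohomology of the Hida tower with `p^s`-torsion coefficients is
finite**: for `F` imaginary quadratic, any tame level, every degree/level/exponent, `H^i(X_{U(r)}, ℤ/p^s)` =
`TameLevel.hidaCohomology ℤ (i, r, s)` is a finite set.  A THEOREM modulo the crux-stub 3a: finiteness of
`GL₂(F)\GL₂(𝔸_F^∞)/U(r)` and Shapiro over the finitely many components are PROVED in the tree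
(`BianchiFiniteness.hidaCohomology_finite_of_bianchi`, `Theorems/…OfBianchiFinitenessHidaFinite.lean`; generic form
`TameLevel.hidaCohomology_finite_of_borelSerre`, p98716); only Borel–Serre for Bianchi congruence subgroups is debt, and it is
now a route item.  The composition applies stub 3 only at the crux's imaginary quadratic `F`, so nothing is lost.
[cite: BorelSerre1973, §11.1] [cite: Brown1982CohomologyGroups, VIII.9 Example 5; VIII (5.1)]
[cite: Borel1963, Thm. 5.1 (finiteness of G(ℚ)\G(𝔸_f)/K)] -/
theorem stub_hidaCohomology_finite : ∀ (F : Type) [Field F] [NumberField F], NumberField.IsTotallyComplex F → Module.finrank ℚ F = 2 → ∀ (p : ℕ) [Fact p.Prime] (𝒰 : Literature.NumberTheory.Automorphic.BigHeckeGLn.TameLevel 2 F p) (ι : Literature.NumberTheory.Automorphic.TowerIndex), Finite (𝒰.hidaCohomology ℤ ι) :=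
  fun F _ _ hF hdeg p _ 𝒰 ι =>
    Summit.Langlands.Langlands.Theorems.SkinnerWilesDefectOne.BianchiFiniteness.hidaCohomology_finite_of_bianchi
      stub_fact_bianchiCongruenceFinite F hdeg hF p 𝒰 ι

/-- **Stub 4 (fact-stub) — the three PRINTED Bianchi inputs of `stub_dominantPointsClassical`, carried as ONE
registered literature debt** (named facts of `Literature/NumberTheory/Automorphic/BianchiOrdinaryClassicality.lean`,
each a `def … : Prop` with its locator; discharge = `theorem …_holds`, after which this bundle is re-registered
smaller): (A) `hidaControl_dominantOrdinaryPoint` [cite: Hida1994AIF, Thm. 2.2, Thm. 3.1 and Thm. 3.2]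
[cite: KhareThorne2017, §6.4 Prop. 6.12–6.13, Cor. 6.14–6.15; §6.5 Lemma 6.16–6.17];
(B) `bianchi_interiorEigenclass_isCuspidal` [cite: Harder1987] [cite: Franke1998, Thm. 18]
[cite: BorelWallach2000, I Thm. 5.3 and III Thm. 3.3]; (C) `bianchi_boundaryEigensystem_isReducible`
[cite: Harder1987] [cite: SerreAbelianLadic1968, Ch. II §2.4–2.8] [cite: KhareThorne2017, §6.5, proof of Thm. 6.23]. -/
theorem stub_facts_bianchiClassicality : Literature.NumberTheory.Automorphic.hidaControl_dominantOrdinaryPoint ∧ Literature.NumberTheory.Automorphic.bianchi_interiorEigenclass_isCuspidal ∧ Literature.NumberTheory.Automorphic.bianchi_boundaryEigensystem_isReducible := by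
  sorry

/-! ## 2. Checks against the landed Negative lemmas, and the rev-3 transfer slot recovered -/

/-- `hunr` is decoration (landed `eventually_isUnramifiedAt_of_isPadicallyAutomorphic`): no stub of
this line needs the a.e.-unramified hypothesis beyond passing it to stub 1. [folklore] -/
theorem hunr_redundant {F : Type} [Field F] [NumberField F] {p : ℕ} [Fact p.Prime]
    {ρ : FramedGaloisRep F (PadicAlgCl p) 2} (hpm : ∃ 𝒰 : TameLevel 2 F p, 𝒰.IsPadicallyAutomorphic ρ) :
    ∀ᶠ v in cofinite, ρ.IsUnramifiedAt v := by
  obtain ⟨𝒰, h𝒰⟩ := hpm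
  exact eventually_isUnramifiedAt_of_isPadicallyAutomorphic 𝒰 h𝒰

/-- **Rev 3's transfer slot (OF⁺), for NON-CM `ρ`, from the stubs 1, 2, 3a** (OF_Iw-nonCM + KT 2.10 +
finiteness ⇒ an ordinary point at a level maximal above `p`, associated with `ρ`, with finite-order slot `0`).
The point is `x` with `x ∘ toOrd = y`; association and the diamond values transfer along `toOrd`
(`toOrd_hidaT`, `toOrd_hidaDiamond`). [folklore] -/
theorem ordinaryFactorisationDominant_of_stubs : ∀ (F : Type) [Field F] [NumberField F], NumberField.IsTotallyComplex F → Module.finrank ℚ F = 2 → ∀ (p : ℕ) [Fact p.Prime], p ≠ 2 → ∀ (ι : PadicAlgCl p ≃+* ℂ) (ρ : Literature.NumberTheory.GaloisRepresentations.FramedGaloisRep F (PadicAlgCl p) 2) (k m : ℕ), ρ.toGaloisRep.IsIrreducible → (¬ ∃ (K : Type) (_ : Field K) (_ : NumberField K) (_ : Algebra F K) (_ : Module.finrank F K = 2) (θ : Literature.NumberTheory.GaloisRepresentations.HeckeCharacter K), θ.IsAlgebraic ∧ (∃ᶠ w : IsDedekindDomain.HeightOneSpectrum (NumberField.RingOfIntegers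 K) in Filter.cofinite, ∃ w' : IsDedekindDomain.HeightOneSpectrum (NumberField.RingOfIntegers K), w'.asIdeal.under (NumberField.RingOfIntegers F) = w.asIdeal.under (NumberField.RingOfIntegers F) ∧ θ.valueAtUniformizer w' ≠ θ.valueAtUniformizer w) ∧ ∀ᶠ v : IsDedekindDomain.HeightOneSpectrum (NumberField.RingOfIntegers F) in Filter.cofinite, ρ.IsUnramifiedAt v ∧ ρ.HasFrobCharpolyAt v (∏ᶠ w ∈ {w : IsDedekindDomain.HeightOneSpectrum (NumberField.RingOfIntegers K) | w.under (NumberField.RingOfIntegers F) = v}, (Polynomial.X ^ w.asIdeal.inertiaDeg (NumberField.RingOfIntegers F) - Polynomial.C (ι.symm (θ.valueAtUniformizer w)⁻¹)))) → (∀ᶠ v in Filter.cofinite, ρ.IsUnramifiedAt v) → (∃ 𝒰 : Literature.NumberTheory.Automorphic.BigHeckeGLn.TameLevel 2 F p, 𝒰.IsPadicallyAutomorphic ρ) → 2 ≤ k → 0 < m → (∀ v : IsDedekindDomain.HeightOneSpectrum (NumberField.RingOfIntegers F), (p : NumberField.RingOfIntegers F) ∈ v.asIdeal → ρ.IsOrdinaryOfWeightAt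 p v k m) → ∃ 𝒰 : Literature.NumberTheory.Automorphic.BigHeckeGLn.TameLevel 2 F p, 𝒰.IsMaximalAbove ∧ ∃ x : Literature.NumberTheory.Automorphic.OrdinaryHeckeAlgebraGLn 𝒰 →+* PadicAlgCl p, Continuous x ∧ 𝒰.IsOrdAssociated x ρ ∧ ∃ N : ℕ, 0 < N ∧ ∀ (u : NumberField.RingOfIntegers F) (û : ∀ v : IsDedekindDomain.HeightOneSpectrum (NumberField.RingOfIntegers F), (p : NumberField.RingOfIntegers F) ∈ v.asIdeal → (v.adicCompletionIntegers F)ˣ), (∀ (v : IsDedekindDomain.HeightOneSpectrum (NumberField.RingOfIntegers F)) (hv : (p : NumberField.RingOfIntegers F) ∈ v.asIdeal), ((û v hv : v.adicCompletionIntegers F) : v.adicCompletion F) = algebraMap F (v.adicCompletion F) (u : F)) → (∏ᶠ v : {v : IsDedekindDomain.HeightOneSpectrum (NumberField.RingOfIntegers F) // (p : NumberField.RingOfIntegers F) ∈ v.asIdeal}, x (𝒰.ordDiamond v.2 (Pi.mulSingle (0 : Fin 2) (û v.1 v.2)))) ^ N = 1 := by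
  intro F _ _ hF hdeg p _ hp ι ρ k m hirr hncm hunr hpm hk hm hv
  obtain ⟨𝒰, h𝒰, y, hy, hass, hslope, N, hN, hslot⟩ :=
    stub_ordinaryFactorisationIwahoriNonCM F hF hdeg p hp ι ρ k m hirr hncm hunr hpm hk hm hv
  obtain ⟨x, hx, hxy⟩ :=
    stub_slopeZeroFactorisation F p 𝒰 h𝒰 (stub_hidaCohomology_finite F hF hdeg p 𝒰) y hy hslope
  refine ⟨𝒰, h𝒰, x, hx, ?_, N, hN, fun u û hû => ?_⟩
  · -- association transfers along `toOrd` (`toOrd T_{w,j} = T_{w,j}`)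
    have hfun : (fun w j => x (𝒰.ordT w j)) = fun w j => y (𝒰.hidaT w j) := by
      funext w j
      rw [← hxy, RingHom.comp_apply, TameLevel.toOrd_hidaT]
    show IsAssociatedFamily 2 𝒰.bad (fun w j => x (𝒰.ordT w j)) ρ
    rw [hfun]
    exact hass
  · -- the diamond values transfer along `toOrd` (`toOrd ⟨u⟩ = ⟨u⟩`, definitional)
    have hdia : ∀ v : {v : HeightOneSpectrum (𝓞 F) // (p : 𝓞 F) ∈ v.asIdeal},
        x (𝒰.ordDiamond v.2 (Pi.mulSingle (0 : Fin 2) (û v.1 v.2))) =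
          y (𝒰.hidaDiamond v.2 (Pi.mulSingle (0 : Fin 2) (û v.1 v.2))) := by
      intro v
      rw [← hxy, RingHom.comp_apply, TameLevel.toOrd_hidaDiamond]
    simp only [hdia]
    exact hslot u û hû

/-! ## 3. The composition: the registered stubs (and the five landed ones) imply the crux BY NAME (pure logic) -/

/-- **The crux from the registered stubs (rev 6).** Case split on the automorphic shape of `ρ` through `ι`: (CM) Frobenius
polynomials induced from a regular algebraic Hecke character of a quadratic `K/F` ⇒ stubs 1b (cuspidal automorphic induction,
L-algebraic) and 1c (Satake–Frobenius glue); (non-CM) ⇒ stubs 1, 2 (landed), 3a give an ordinary point `x` at a level maximal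
above `p` with finite-order slot-`0` diamond character (`ordinaryFactorisationDominant_of_stubs`), and the LANDED exit
`classical_of_ordinaryPoint` (p96987 = central weight p85822 + glue p89308 + dominant points classical p89646 modulo the three
facts of stub 4 + Satake dictionary p86662) gives the L-algebraic cuspidal `π` with the summit's Satake–Frobenius clause.
[folklore] -/
theorem ProModularOrdinaryClassical_proof : ProModularOrdinaryClassical := by
  intro F _ _ hF hdeg p _ hp hcpt ι ρ hirr hunr hpm hord
  by_cases hcm : ∃ (K : Type) (_ : Field K) (_ : NumberField K) (_ : Algebra F K) (_ : Module.finrank F K = 2)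
      (θ : HeckeCharacter K), θ.IsAlgebraic ∧
        (∃ᶠ w : HeightOneSpectrum (𝓞 K) in cofinite, ∃ w' : HeightOneSpectrum (𝓞 K),
          w'.asIdeal.under (𝓞 F) = w.asIdeal.under (𝓞 F) ∧ θ.valueAtUniformizer w' ≠ θ.valueAtUniformizer w) ∧
        ∀ᶠ v : HeightOneSpectrum (𝓞 F) in cofinite, ρ.IsUnramifiedAt v ∧
          ρ.HasFrobCharpolyAt v (∏ᶠ w ∈ {w : HeightOneSpectrum (𝓞 K) | w.under (𝓞 F) = v},
            (X ^ w.asIdeal.inertiaDeg (𝓞 F) - C (ι.symm (θ.valueAtUniformizer w)⁻¹)))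
  · -- the CM regime: cuspidal automorphic induction of `θ`, no (OF) needed (stub 1b with (C) discharged at rank 2 =
    -- the landed `cmInducedCuspidal_of_two_facts`, stub 1c, fact-stub 1d = (A) ∧ (B))
    obtain ⟨K, iK, iN, iA, hK, θ, halg, hreg, hfrob⟩ := hcm
    obtain ⟨π, hLalg, hsat⟩ :=
      @Summit.Langlands.Langlands.Theorems.SkinnerWilesDefectOne.GivenBianchiFiniteness.cmInducedCuspidal_of_two_facts
        stub_facts_automorphicInductionAB.1 stub_facts_automorphicInductionAB.2 F _ _ hcpt K iK iN iA hK θ halg hreg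
    exact ⟨π, hLalg, @stub_cmSatakeFrobGlue F _ _ p _ hcpt ι ρ K iK iN iA hK θ π hsat hfrob⟩
  · -- the non-CM regime: (OF_Iw-nonCM) + KT 2.10 + finiteness, then the landed exit `classical_of_ordinaryPoint`
    obtain ⟨k, hk, m, hm, hv⟩ := hord
    obtain ⟨𝒰, h𝒰, x, hx, hass, hslot⟩ :=
      ordinaryFactorisationDominant_of_stubs F hF hdeg p hp ι ρ k m hirr hcm hunr hpm hk hm hv
    exact classical_of_ordinaryPoint stub_facts_bianchiClassicality.1 stub_facts_bianchiClassicality.2.1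
      stub_facts_bianchiClassicality.2.2 F hF hdeg p hp hcpt ι ρ 𝒰 x k m hirr h𝒰 hx hass hk hm hv hslot

end

end Summit.Langlands.Langlands.Cruxes.ProModularOrdinaryClassical.TopDegreeExactControl
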